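import Mathlib.Algebra.Polynomial.RuleOfSigns
import Mathlib.Algebra.Polynomial.Roots
import Mathlib.Algebra.Polynomial.Degree.Lemmas
import Literature.Computability.AlgebraicComplexity.TauConjecture
import HarnessLib

/-!
# Known cases of Koiran's real τ-conjecture

`Literature.Computability.AlgebraicComplexity.KoiranRealTauConjecture` (Koiran, ICS 2011, §6
Conjecture 3) is an **open problem** (status re-checked 2026-08: Bürgisser's 2024 survey
*Completeness classes in algebraic complexity theory*, §4, Conjecture 4.1 "Real τ-conjecture"
(bib key `Burgisser2024`); Briquel–Bürgisser 2020, Conj. 1 (`BriquelBurgisser2020`)), so it has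
no `_holds` theorem — an open problem is never asserted (CONVENTIONS §4). This file proves, from
Mathlib's Descartes rule of signs (`Polynomial.roots_countP_pos_le_signVariations`), exactly the
partial evidence printed in the source right after the conjecture (Koiran 2011, §6, p. 317 of the
ICS version = p. 11 of arXiv:1004.4960v4):

* "by Descartes' rule each polynomial `f_{1j}` has at most `2t - 2` nonzero real roots"
  (`card_roots_toFinset_filter_ne_zero_le`: a nonzero real polynomial with at most `t`
  monomials has at most `2(t-1)` distinct nonzero real zeros), via the sparse form of Descartes'
  rule `card_roots_toFinset_filter_pos_lt_card_support` (distinct positive zeros `<` number of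
  monomials) and its mirror image for negative zeros;
* the case `k = 1` of the conjecture: "so `f` has at most `2m(t-1)+1` real roots"
  (`card_roots_toFinset_prod_sparse_le`, and in the literal shape of the conjecture with
  exponent `c = 2`, `koiranRealTauConjecture_case_k_eq_one`);
* the trivial bound "in the general case we can expand `f` as a sum of at most `kt^m` monomials,
  so we have at most `2kt^m - 1` real roots" (`card_roots_toFinset_sumProd_sparse_le`).

Everything is stated over a linearly ordered commutative ring `R` with `IsStrictOrderedRing R`
(e.g. `ℝ`), the generality of Mathlib's rule of signs; "distinct real zeros" of `P` is
`P.roots.toFinset`, as in `KoiranRealTauConjecture`.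

## References

* P. Koiran, *Shallow circuits with high-powered inputs*, Innovations in Computer Science
  (ICS 2011) 309–320 (= arXiv:1004.4960v4), §6, Conjecture 3 and the two paragraphs after
  Proposition 2 (p. 317).
* P. Bürgisser, *Completeness classes in algebraic complexity theory*, arXiv:2406.06217 (2024),
  §4, Conjecture 4.1 (status: open) — bib key `Burgisser2024`.
* I. Briquel, P. Bürgisser, *The real tau-conjecture is true on average*, Random Structures &
  Algorithms 57 (2020) 279–303, Conjecture 1 — bib key `BriquelBurgisser2020`.
-/

noncomputable section

open Polynomial Finset

namespace Literature.Computability.AlgebraicComplexity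

section Semiring

variable {R : Type*} [Semiring R]

/-- The number of sign variations of a nonzero polynomial is less than its number of monomials
(each variation sits between two consecutive nonzero coefficients). [folklore] -/
theorem signVariations_lt_card_support [LinearOrder R] {P : R[X]} (hP : P ≠ 0) :
    P.signVariations < P.support.card := by
  suffices h : ∀ n : ℕ, ∀ Q : R[X], Q ≠ 0 → Q.support.card = n → Q.signVariations < n from
    h _ P hP rfl
  intro n
  induction n with
  | zero => intro Q hQ h0; exact absurd (card_support_eq_zero.mp h0) hQ
  | succ n ih =>
    intro Q hQ hcard
    by_cases hE : Q.eraseLead = 0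
    · have hmono : Q = monomial Q.natDegree Q.leadingCoeff := by
        conv_lhs => rw [← eraseLead_add_monomial_natDegree_leadingCoeff Q, hE, zero_add]
      rw [hmono, signVariations_monomial]
      exact Nat.succ_pos n
    · have hc : Q.eraseLead.support.card = n := by
        have := card_support_eraseLead_add_one hQ
        omega
      have := ih _ hE hc
      calc Q.signVariations ≤ Q.eraseLead.signVariations + 1 := signVariations_le_eraseLead_succ Q
        _ < n + 1 := by omega

/-- The number of monomials of a finite product of polynomials is at most the product of the
numbers of monomials of the factors. [folklore] -/
theorem card_support_prod_le {ι : Type*} {S : Type*} [CommSemiring S] (s : Finset ι)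
    (f : ι → S[X]) : (∏ j ∈ s, f j).support.card ≤ ∏ j ∈ s, (f j).support.card := by
  classical
  induction s using Finset.cons_induction with
  | empty =>
    rw [prod_empty, prod_empty, ← monomial_zero_one]
    exact (card_le_card (support_monomial_subset 0 (1 : S))).trans (by simp)
  | cons a s ha ih =>
    rw [prod_cons, prod_cons]
    exact card_support_mul_le.trans (Nat.mul_le_mul_left _ ih)

/-- The number of monomials of a finite sum of polynomials is at most the sum of the numbers of
monomials of the summands. [folklore] -/
theorem card_support_sum_le {ι : Type*} (s : Finset ι) (f : ι → R[X]) :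
    (∑ i ∈ s, f i).support.card ≤ ∑ i ∈ s, (f i).support.card := by
  classical
  induction s using Finset.cons_induction with
  | empty => simp
  | cons a s ha ih =>
    rw [sum_cons, sum_cons]
    exact (card_le_card support_add).trans ((card_union_le _ _).trans (Nat.add_le_add_left ih _))

end Semiring

section CommRing

variable {S : Type*} [CommRing S]

/-- Coefficients of `P(-X)`: `[X^k] P(-X) = (-1)^k [X^k] P`. [folklore] -/
theorem coeff_comp_neg_X (P : S[X]) (k : ℕ) : (P.comp (-X)).coeff k = (-1) ^ k * P.coeff k := by
  induction P using Polynomial.induction_on' with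
  | add p q hp hq => rw [add_comp, coeff_add, coeff_add, hp, hq, mul_add]
  | monomial n a =>
    rw [monomial_comp, neg_pow, ← mul_assoc, coeff_monomial]
    have : C a * (-1 : S[X]) ^ n = C (a * (-1) ^ n) := by simp
    rw [this, coeff_C_mul_X_pow]
    split_ifs with h1 h2 h2
    · subst h2; ring
    · exact absurd h1.symm h2
    · exact absurd h2.symm h1
    · simp

/-- `P(-X)` has the same set of exponents as `P`. [folklore] -/
theorem support_comp_neg_X (P : S[X]) : (P.comp (-X)).support = P.support := by
  ext k
  rw [mem_support_iff, mem_support_iff, coeff_comp_neg_X, Ne, neg_one_pow_mul_eq_zero_iff]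

end CommRing

section StrictOrderedRing

variable {R : Type*} [CommRing R] [LinearOrder R] [IsStrictOrderedRing R]

/-- **Descartes' rule of signs, sparse form**: a nonzero polynomial over a linearly ordered
(strictly ordered, commutative) ring has fewer distinct positive zeros than monomials.
Immediate from Mathlib's `Polynomial.roots_countP_pos_le_signVariations` and
`signVariations_lt_card_support`. [folklore] -/
theorem card_roots_toFinset_filter_pos_lt_card_support {P : R[X]} (hP : P ≠ 0) :
    (P.roots.toFinset.filter (0 < ·)).card < P.support.card := by
  calc (P.roots.toFinset.filter (0 < ·)).card
      = (P.roots.filter (0 < ·)).toFinset.card := by rw [Multiset.toFinset_filter]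
    _ ≤ (P.roots.filter (0 < ·)).card := Multiset.toFinset_card_le _
    _ = P.roots.countP (0 < ·) := (Multiset.countP_eq_card_filter _ _).symm
    _ ≤ P.signVariations := roots_countP_pos_le_signVariations P
    _ < P.support.card := signVariations_lt_card_support hP

/-- Mirror image of `card_roots_toFinset_filter_pos_lt_card_support`: a nonzero polynomial has
fewer distinct negative zeros than monomials (apply the positive case to `P(-X)`). [folklore] -/
theorem card_roots_toFinset_filter_neg_lt_card_support {P : R[X]} (hP : P ≠ 0) :
    (P.roots.toFinset.filter (· < 0)).card < P.support.card := by
  have hQ : P.comp (-X) ≠ 0 := fun h => hP (comp_neg_X_eq_zero_iff.mp h)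
  have h1 := card_roots_toFinset_filter_pos_lt_card_support hQ
  rw [support_comp_neg_X, roots_comp_neg_X] at h1
  refine lt_of_le_of_lt (card_le_card_of_injOn (fun x => -x) ?_ ?_) h1
  · intro x hx
    simp only [coe_filter, Set.mem_setOf_eq, Multiset.mem_toFinset, Multiset.mem_map] at hx ⊢
    exact ⟨⟨x, hx.1, rfl⟩, neg_pos.mpr hx.2⟩
  · exact fun x _ y _ h => neg_injective h

/-- "By Descartes' rule each [nonzero] polynomial with at most `t` monomials has at most `2t - 2`
nonzero real roots" (Koiran 2011, §6, p. 317): distinct nonzero zeros of `P ≠ 0` number at most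
`2 (#monomials - 1)`. [cite: Koiran2011, §6 p. 317 (paragraph after Prop. 2)] -/
theorem card_roots_toFinset_filter_ne_zero_le {P : R[X]} (hP : P ≠ 0) :
    (P.roots.toFinset.filter (· ≠ 0)).card ≤ 2 * (P.support.card - 1) := by
  have hpos := card_roots_toFinset_filter_pos_lt_card_support hP
  have hneg := card_roots_toFinset_filter_neg_lt_card_support hP
  have hsplit : P.roots.toFinset.filter (· ≠ 0) =
      P.roots.toFinset.filter (· < 0) ∪ P.roots.toFinset.filter (0 < ·) := by
    ext x
    simp only [mem_filter, mem_union]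
    constructor
    · rintro ⟨hx, hx0⟩
      rcases lt_or_gt_of_ne hx0 with h | h
      · exact Or.inl ⟨hx, h⟩
      · exact Or.inr ⟨hx, h⟩
    · rintro (⟨hx, h⟩ | ⟨hx, h⟩)
      · exact ⟨hx, h.ne⟩
      · exact ⟨hx, h.ne'⟩
  rw [hsplit]
  calc _ ≤ (P.roots.toFinset.filter (· < 0)).card + (P.roots.toFinset.filter (0 < ·)).card :=
        card_union_le _ _
    _ ≤ 2 * (P.support.card - 1) := by omega

/-- A nonzero polynomial with `s` monomials over a linearly ordered ring has at most `2(s-1)+1`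
distinct zeros in that ring (the nonzero ones, plus possibly `0`). [folklore] -/
theorem card_roots_toFinset_le_of_card_support {P : R[X]} (hP : P ≠ 0) :
    P.roots.toFinset.card ≤ 2 * (P.support.card - 1) + 1 := by
  have h := card_roots_toFinset_filter_ne_zero_le hP
  have hsub : P.roots.toFinset ⊆ insert 0 (P.roots.toFinset.filter (· ≠ 0)) := by
    intro x hx
    by_cases hx0 : x = 0
    · simp [hx0]
    · exact mem_insert_of_mem (mem_filter.mpr ⟨hx, hx0⟩)
  calc P.roots.toFinset.card ≤ (insert (0 : R) (P.roots.toFinset.filter (· ≠ 0))).card :=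
        card_le_card hsub
    _ ≤ (P.roots.toFinset.filter (· ≠ 0)).card + 1 := card_insert_le _ _
    _ ≤ 2 * (P.support.card - 1) + 1 := by omega

/-- **The case `k = 1` of the real τ-conjecture** (Koiran 2011, §6, p. 317: "We do know that the
conjecture holds true when `k = 1`: by Descartes' rule each polynomial `f_{1j}` has at most `2t-2`
nonzero real roots, so `f` has at most `2m(t-1)+1` real roots"). Finset-indexed form: a nonzero
product of `#s` polynomials, each with at most `t` monomials, has at most `2 · #s · (t-1) + 1`
distinct zeros. [cite: Koiran2011, §6 p. 317 (case k = 1)] -/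
theorem card_roots_toFinset_prod_sparse_le {ι : Type*} (s : Finset ι) {t : ℕ} (f : ι → R[X])
    (hf : ∀ j ∈ s, (f j).support.card ≤ t) (hF : ∏ j ∈ s, f j ≠ 0) :
    (∏ j ∈ s, f j).roots.toFinset.card ≤ 2 * s.card * (t - 1) + 1 := by
  classical
  have hfj : ∀ j ∈ s, f j ≠ 0 := fun j hj h => hF (prod_eq_zero hj h)
  -- nonzero zeros of the product are nonzero zeros of some factor
  have hsub : (∏ j ∈ s, f j).roots.toFinset.filter (· ≠ 0) ⊆
      s.biUnion fun j => (f j).roots.toFinset.filter (· ≠ 0) := by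
    intro x hx
    simp only [mem_filter, Multiset.mem_toFinset, mem_roots hF, IsRoot.def, eval_prod,
      prod_eq_zero_iff] at hx
    obtain ⟨⟨j, hj, hjx⟩, hx0⟩ := hx
    simp only [mem_biUnion, mem_filter, Multiset.mem_toFinset]
    exact ⟨j, hj, (mem_roots (hfj j hj)).mpr (IsRoot.def.mpr hjx), hx0⟩
  have hnz : ((∏ j ∈ s, f j).roots.toFinset.filter (· ≠ 0)).card ≤ s.card * (2 * (t - 1)) := by
    calc _ ≤ (s.biUnion fun j => (f j).roots.toFinset.filter (· ≠ 0)).card := card_le_card hsub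
      _ ≤ ∑ j ∈ s, ((f j).roots.toFinset.filter (· ≠ 0)).card := card_biUnion_le
      _ ≤ ∑ j ∈ s, 2 * (t - 1) := sum_le_sum fun j hj =>
          (card_roots_toFinset_filter_ne_zero_le (hfj j hj)).trans (by have := hf j hj; omega)
      _ = s.card * (2 * (t - 1)) := by simp
  have hsub0 : (∏ j ∈ s, f j).roots.toFinset ⊆
      insert 0 ((∏ j ∈ s, f j).roots.toFinset.filter (· ≠ 0)) := by
    intro x hx
    by_cases hx0 : x = 0
    · simp [hx0]
    · exact mem_insert_of_mem (mem_filter.mpr ⟨hx, hx0⟩)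
  calc (∏ j ∈ s, f j).roots.toFinset.card
      ≤ (insert (0 : R) ((∏ j ∈ s, f j).roots.toFinset.filter (· ≠ 0))).card := card_le_card hsub0
    _ ≤ ((∏ j ∈ s, f j).roots.toFinset.filter (· ≠ 0)).card + 1 := card_insert_le _ _
    _ ≤ s.card * (2 * (t - 1)) + 1 := by omega
    _ = 2 * s.card * (t - 1) + 1 := by ring

/-- **The trivial bound** (Koiran 2011, §6, p. 317: "In the general case we can expand `f` as a
sum of at most `kt^m` monomials, so we have at most `2kt^m - 1` real roots"): for
`F = ∑_{i<k} ∏_{j<m} f i j ≠ 0` with every `f i j` having at most `t` monomials, `F` has at most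
`k t^m` monomials and hence at most `2 k t^m - 1` distinct zeros.
[cite: Koiran2011, §6 p. 317 (bound 2kt^m - 1)] -/
theorem card_roots_toFinset_sumProd_sparse_le {k m t : ℕ} (f : Fin k → Fin m → R[X])
    (hf : ∀ i j, (f i j).support.card ≤ t) (hF : (∑ i, ∏ j, f i j) ≠ 0) :
    (∑ i, ∏ j, f i j).roots.toFinset.card ≤ 2 * (k * t ^ m) - 1 := by
  have hsupp : (∑ i, ∏ j, f i j).support.card ≤ k * t ^ m := by
    calc _ ≤ ∑ i, (∏ j, f i j).support.card := card_support_sum_le _ _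
      _ ≤ ∑ i, ∏ j, (f i j).support.card := sum_le_sum fun i _ => card_support_prod_le _ _
      _ ≤ ∑ _i : Fin k, ∏ _j : Fin m, t :=
          sum_le_sum fun i _ => prod_le_prod (fun j _ => Nat.zero_le _) fun j _ => hf i j
      _ = k * t ^ m := by simp
  have hpos : 0 < (∑ i, ∏ j, f i j).support.card :=
    card_pos.mpr (nonempty_iff_ne_empty.mpr (mt support_eq_empty.mp hF))
  have h := card_roots_toFinset_le_of_card_support hF
  generalize k * t ^ m = N at hsupp
  omega

/-- **Koiran's real τ-conjecture holds for `k = 1`**, in the literal shape of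
`KoiranRealTauConjecture` (its body at `k = 1`, with exponent `c = 2`): for `f : Fin 1 → Fin m →
R[X]` with every `f 0 j` having at most `t` monomials and `F = ∑_{i<1} ∏_{j<m} f i j ≠ 0`, the
number of distinct zeros of `F` is at most `(1 + m + t + 2)^2` (indeed at most `2m(t-1)+1`,
`card_roots_toFinset_prod_sparse_le`). [cite: Koiran2011, §6 p. 317 (case k = 1)] -/
theorem koiranRealTauConjecture_case_k_eq_one (m t : ℕ) (f : Fin 1 → Fin m → R[X])
    (hf : ∀ i j, (f i j).support.card ≤ t) (hF : (∑ i, ∏ j, f i j) ≠ 0) :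
    (∑ i, ∏ j, f i j).roots.toFinset.card ≤ (1 + m + t + 2) ^ 2 := by
  have hsum : (∑ i, ∏ j, f i j) = ∏ j, f 0 j := Fin.sum_univ_one _
  rw [hsum] at hF ⊢
  have h := card_roots_toFinset_prod_sparse_le (univ : Finset (Fin m)) (fun j => f 0 j)
    (fun j _ => hf 0 j) hF
  rw [card_univ, Fintype.card_fin] at h
  calc (∏ j, f 0 j).roots.toFinset.card ≤ 2 * m * (t - 1) + 1 := h
    _ ≤ 2 * m * t + 1 := by gcongr; exact Nat.sub_le t 1
    _ ≤ (1 + m + t + 2) ^ 2 := by nlinarith [Nat.zero_le (m * t), Nat.zero_le m, Nat.zero_le t]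

/-- The real τ-conjecture restricted to `k ≤ 1` sums, as a closed statement of the same shape as
`KoiranRealTauConjecture` (exponent `c = 2`; the case `k = 0` is vacuous since then `F = 0`).
[cite: Koiran2011, §6 p. 317 (case k = 1)] -/
theorem koiranRealTauConjecture_of_k_le_one :
    ∃ c : ℕ, ∀ (k m t : ℕ) (f : Fin k → Fin m → R[X]), k ≤ 1 →
      (∀ i j, (f i j).support.card ≤ t) → (∑ i, ∏ j, f i j) ≠ 0 →
        (∑ i, ∏ j, f i j).roots.toFinset.card ≤ (k + m + t + 2) ^ c := by
  refine ⟨2, fun k m t f hk hf hF => ?_⟩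
  rcases Nat.le_one_iff_eq_zero_or_eq_one.mp hk with rfl | rfl
  · simp at hF
  · exact koiranRealTauConjecture_case_k_eq_one m t f hf hF

end StrictOrderedRing

end Literature.Computability.AlgebraicComplexity
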